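import Summits.CriticalPhenomena.CardyFormulaZ2.Theorems.CardyComplexConeEdgePrecompactUFRSArmDominationJ
import Summits.CriticalPhenomena.CardyFormulaZ2.Theorems.CardyComplexConeEdgePrecompactUFRSPiecesJ
import Summits.CriticalPhenomena.CardyFormulaZ2.Theorems.CardyComplexConeEdgePrecompactUFRSCollarDecayRect
import Summits.CriticalPhenomena.CardyFormulaZ2.Theorems.CardyComplexConeEdgePrecompactUFRSRectBoundaryStrandDecay
import Summits.CriticalPhenomena.CardyFormulaZ2.Theorems.CardyComplexConeEdgePrecompactUFRSOneStrandDecay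

/-!
# UFRS for axis-parallel rectangles from the leaves of the line, J-form
(line `qkz-strip-boundary-arm` of crux `CardyComplexCone.EdgePrecompact`, stmt-CriticalPhenomena-11387;
assembly of the registered sub-goal `ufrs_rect` — the uniform forward response stability "UFRS"
for axis-parallel rectangles — from the open leaves of the corrected road map: module docstrings
of `…UFRSAnnulusCrossings.lean` (correction), `…UFRSEvents.lean` (vocabulary), `…UFRSPieces.lean`
(glue), `…UFRSResidualsJ.lean` (junction event and J-form residuals))

`ufrs_rect_of_leavesJ` (registered): the registered statement of `ufrs_rect`, verbatim, follows
from FIVE named leaves, all taken as hypotheses: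
* `ufrsResidualSlippedReturnJ`, `ufrsResidualInitialContactJ` — the J-forms of the two remaining
  residual planar configurations of the arm domination (registered sub-goals
  `ufrs_slippedReturnCase_certJ`, `ufrs_initialContactCase_certJ`);
* HJ = `ufrs_rect_junctionTwoStrandDecay` (junction two-strand decay at the marked edges);
* HT = `ufrs_rect_flatThreeStrandDecay` (flat three-strand decay away from the marked edges);
* M4 = `ufrs_markedPointDecay_rect` (decay of the MARKED ∪ NEAR branches of the certificate;
  its proof from HJ and HT is `ufrs_markedPointDecay_rect_of_bridges`).
Proof, a composition of landed glue: the J-form arm domination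
`ufrs_armDominationJ_of_residuals` (`…UFRSArmDominationJ.lean`); the boundary strand decay
`ufrs_rectBoundaryStrandDecay_of_bridges` from HT, HJ and the proved one-strand decay
`ufrs_rect_oneStrandDecay` (`…UFRSOneStrandDecay.lean`); the FAR-branch decay
`ufrs_screenedCollarDecay_rect_of_boundaryStrandDecay` (`…UFRSCollarDecayRect.lean`); the
junction-event decay `ufrs_junctionDecay_rect_of_HJ` and the glue `ufrs_of_piecesJ`
(`…UFRSPiecesJ.lean`).

References: S. Smirnov, C. R. Acad. Sci. Paris 333 (2001), §2; G. F. Lawler, O. Schramm,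
W. Werner, Electron. J. Probab. 7 (2002), App. A; P. Nolin, Electron. J. Probab. 13 (2008), §4.
-/

namespace Summit.CriticalPhenomena.CardyFormulaZ2.Cruxes.EdgePrecompact.QkzStripBoundaryArm

open MeasureTheory Filter Set Metric
open scoped Topology BigOperators Pointwise
open Literature.Probability.LatticeModels Literature.Probability.Percolation
open Literature.Probability.RandomPlanarGeometry (DobrushinDomain)
open Summit.CriticalPhenomena.CardyFormulaZ2.Theses.CardyComplexCone

noncomputable section

/-- **UFRS for axis-parallel rectangles from the five leaves** (registered sub-goal
`ufrs_rect_of_leavesJ` of stmt-CriticalPhenomena-11387). HYPOTHESES, in order: the J-form residuals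
`ufrsResidualSlippedReturnJ`, `ufrsResidualInitialContactJ` (`…UFRSResidualsJ.lean`); HJ (verbatim
the registered `ufrs_rect_junctionTwoStrandDecay`); HT (verbatim the registered
`ufrs_rect_flatThreeStrandDecay`); M4 (verbatim the registered `ufrs_markedPointDecay_rect`).
CONCLUSION: the registered statement of `ufrs_rect` verbatim. Proof:
`ufrs_of_piecesJ D (ufrs_armDominationJ_of_residuals SR IC D) (FAR decay from
ufrs_rectBoundaryStrandDecay_of_bridges HT HJ ufrs_rect_oneStrandDecay) (M4 D) (junction decay from HJ)`. -/
theorem ufrs_rect_of_leavesJ : ufrsResidualSlippedReturnJ → ufrsResidualInitialContactJ → (∀ (D : DobrushinDomain), (∃ x₀ x₁ y₀ y₁ : ℝ, x₀ < x₁ ∧ y₀ < y₁ ∧ D.carrier = Set.Ioo x₀ x₁ ×ℂ Set.Ioo y₀ y₁) → ∃ C β : ℝ, 0 < C ∧ 0 < β ∧ ∃ η₀ > (0:ℝ), ∀ η : ℝ, 0 < η → η < η₀ → ∃ δ₀ > (0:ℝ), ∀ E : DiscreteDobrushin, E.Ω = D.carrier → E.IsZdAdmissible → E.δ < δ₀ →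 ∀ w : Site 2, ‖meshPoint E.δ w‖ < η → ∀ e₀ : Sym2 (Site 2), (e₀ ∈ E.zdABEdges ∨ e₀ ∈ (shiftData E w).zdABEdges) → ∀ s S : ℝ, η ≤ s → 0 < S → (bondPercolation (zdGraph 2) half).real (ufrsStrands E w (medialPoint E.δ e₀) 2 s S) ≤ C * (s / S) ^ β) → (∀ (D : DobrushinDomain), (∃ x₀ x₁ y₀ y₁ : ℝ, x₀ < x₁ ∧ y₀ < y₁ ∧ D.carrier = Set.Ioo x₀ x₁ ×ℂ Set.Ioo y₀ y₁) → ∃ C α : ℝ, 0 < C ∧ 0 < α ∧ ∃ η₀ > (0:ℝ), ∀ η : ℝ, 0 < η → η < η₀ → ∃ δ₀ > (0:ℝ), ∀ E : DiscreteDobrushin, E.Ω = D.carrier → E.IsZdAdmissible → E.δ < δ₀ → ∀ w : Site 2, ‖meshPoint E.δ w‖ < η → ∀ (z : ℂ) (s S : ℝ), z ∈ D.carrier → infDist z D.carrierᶜ ≤ s → η ≤ s → 0 < S → (∀ e₀ : Sym2 (Site 2), (e₀ ∈ E.zdABEdges ∨ e₀ ∈ (shiftData E w).zdABEdges) → 2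 * S ≤ dist (medialPoint E.δ e₀) z) → (bondPercolation (zdGraph 2) half).real (ufrsStrands E w z 3 s S) ≤ C * (s / S) ^ (1 + α)) → (∀ (D : DobrushinDomain), (∃ x₀ x₁ y₀ y₁ : ℝ, x₀ < x₁ ∧ y₀ < y₁ ∧ D.carrier = Set.Ioo x₀ x₁ ×ℂ Set.Ioo y₀ y₁) → ∀ ρ > (0:ℝ), ∀ ε > (0:ℝ), ∃ η₁ > (0:ℝ), ∀ η : ℝ, 0 < η → η < η₁ → ∃ δ₀ > (0:ℝ), ∀ E : DiscreteDobrushin, E.Ω = D.carrier → E.IsZdAdmissible → E.δ < δ₀ → ∀ w : Site 2, ‖meshPoint E.δ w‖ < η → (bondPercolation (zdGraph 2) half).real {ω : BondConfig (Site 2) | ∃ z ∈ D.carrier, infDist z D.carrierᶜ < 3 * η ∧ ω ∈ ufrsCertMarked E w z (4 * η) (ρ / 2) ∪ ufrsCertNear E w z (4 * η) (ρ / 2)} ≤ ε) → ∀ (D : DobrushinDomain), (∃ x₀ x₁ y₀ y₁ : ℝ, x₀ < x₁ ∧ y₀ < y₁ ∧ D.carrier = Set.Ioo x₀ x₁ ×ℂ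 Set.Ioo y₀ y₁) → ∀ (K : Set ℂ), IsCompact K → K ⊆ D.carrier → ∀ ρ > (0:ℝ), cthickening (2 * ρ) K ⊆ D.carrier → ∀ ε > (0:ℝ), ∃ η > (0:ℝ), ∃ δ₀ > (0:ℝ), ∀ E : DiscreteDobrushin, E.Ω = D.carrier → E.IsZdAdmissible → E.δ < δ₀ → ∀ v w : Site 2, meshPoint E.δ v ∈ K → ‖meshPoint E.δ w‖ < η → (bondPercolation (zdGraph 2) half).real {ω : BondConfig (Site 2) | ¬ ∀ a a' : Site 2 × Fin 4, ((E.IsStartCorner a ∧ (shiftData E w).IsStartCorner a') ∨ (a = a' ∧ medialPoint E.δ (cSrc a) ∈ ball (meshPoint E.δ v) ρ ∧ medialPoint E.δ (cTgt a) ∉ ball (meshPoint E.δ v) ρ)) → ∀ n : ℕ, (∀ i < n, medialPoint E.δ (cTgt (cornerOrbit (E.bcBondConfig ω) a i)) ∉ ball (meshPoint E.δ v) ρ ∧ E.IsInnerFace (cFace (cornerOrbit (E.bcBondConfig ω) a (i + 1)))) → medialPoint E.δ (cTgt (cornerOrbit (E.bcBondConfig ω) a n)) ∈ ball (meshPoint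 E.δ v) ρ → ∃ n' : ℕ, (∀ i < n', medialPoint E.δ (cTgt (cornerOrbit ((shiftData E w).bcBondConfig ω) a' i)) ∉ ball (meshPoint E.δ v) ρ ∧ (shiftData E w).IsInnerFace (cFace (cornerOrbit ((shiftData E w).bcBondConfig ω) a' (i + 1)))) ∧ cornerOrbit ((shiftData E w).bcBondConfig ω) a' n' = cornerOrbit (E.bcBondConfig ω) a n ∧ ∑ i ∈ Finset.range n', turnOf ((shiftData E w).bcBondConfig ω) (cornerOrbit ((shiftData E w).bcBondConfig ω) a' i) = ∑ i ∈ Finset.range n, turnOf (E.bcBondConfig ω) (cornerOrbit (E.bcBondConfig ω) a i)} ≤ ε := by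
  intro hSR hIC hHJ hHT hM4 D hrect
  exact ufrs_of_piecesJ D (ufrs_armDominationJ_of_residuals hSR hIC D)
    (ufrs_screenedCollarDecay_rect_of_boundaryStrandDecay
      (ufrs_rectBoundaryStrandDecay_of_bridges hHT hHJ ufrs_rect_oneStrandDecay) D hrect)
    (hM4 D hrect) (ufrs_junctionDecay_rect_of_HJ hHJ D hrect)

end

end Summit.CriticalPhenomena.CardyFormulaZ2.Cruxes.EdgePrecompact.QkzStripBoundaryArm
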